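import Literature.MathematicalPhysics.QuantumFieldTheory.Balaban1983to89.T3Thresholds
import HarnessLib

/-!
# Crux stmt-QuantumFields-19936 `HistoryTailL`, K2 at depth (route crux `BlockLipschitzL`, stmt-QuantumFields-23533): BAŁABAN'S THRESHOLDS ARE
# SUMMABLE OVER THE HEIGHTS, UNIFORMLY — `Σ_{n ∈ s} θ(n) ≤ C(b₀,p₀)·γ^{1/4}/(1 − L^{−1/4})` for every finite set of heights, hence `≤ σ` once `γ ≤ γ₁(b₀,p₀,σ)`

WHY (card v1.26/v1.27 (R4), w2 g10's supplier plan d4b68d58 §2 (i-c)).  The k-fold true-linearisation bricks of the 19200 lane are k-UNIFORM exactly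
when the per-level loop-variable sizes of the background tower are summable, `Σ_{i<k} a_i = O(1)` (✓`Prop7TrueLinIterDefect.sqrt_sum_normSq_reduced_sub_lineIter_le`:
factor `exp((κ/ρ)·Σ_{i<k} a_i)`); on hStab's good set `a_i ≲ (perimeter)·θBal(K−i)`, so the input is a bound on `Σ_i θBal(K−i)` uniform in `K` and in the
number of levels.  THIS FILE supplies it from the tree's `θ(i) ≤ b₀(2p₀)^{p₀}e^{½−p₀}·(γ·L^{−i})^{1/4}` (✓`T3Thresholds.θBal_le_const_mul_sqrt_coupling`):
the thresholds decay GEOMETRICALLY in the height with ratio `L^{−1/4}`, so every finite sum is `≤ C(b₀,p₀)·γ^{1/4}·(1 − L^{−1/4})⁻¹`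
(`sum_θBal_le`), and `≤ σ` for all `L ≥ 2`, all finite height sets, once `γ ≤ γ₁(b₀, p₀, σ)` (`exists_gamma_forall_sum_θBal_le`).

Pure real analysis over the tree's `θBal`; def-free.  Nothing of hStab, `BlockLipschitzL`, `HistoryTailL`, rung R3 (YM₃ on T³ — not d = 4, not Clay) or
a summit statement is proved.  LEAD seat ym-ust-19936-w1 g7 (cell ym3-torus), `--supports stmt-QuantumFields-23533`.
-/

noncomputable section

open scoped BigOperators

namespace Summit.QuantumFields.YangMills.Theorems.PoincareLipschitzThresholdSums

open Literature.MathematicalPhysics.QuantumFieldTheory.Balaban1983to89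
open Literature.MathematicalPhysics.QuantumFieldTheory.Balaban1983to89.T3UnitScaleTilt (θBal)

/-- `√(q^i) = (√q)^i` for `q ≥ 0`. [folklore] -/
private theorem sqrt_pow_eq {q : ℝ} (hq : 0 ≤ q) : ∀ i : ℕ, Real.sqrt (q ^ i) = Real.sqrt q ^ i
  | 0 => by simp
  | i + 1 => by rw [pow_succ, Real.sqrt_mul (pow_nonneg hq i), sqrt_pow_eq hq i, pow_succ]

/-- The quartic root of the height-`i` coupling factorises: `√(√(γ·L^{−i})) = √(√γ)·(√(√(L⁻¹)))^i`. [folklore] -/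
theorem sqrt_sqrt_coupling_eq {L : ℕ} {γ : ℝ} (hγ : 0 ≤ γ) (i : ℕ) :
    Real.sqrt (Real.sqrt (γ * ((L : ℝ)⁻¹) ^ i)) = Real.sqrt (Real.sqrt γ) * Real.sqrt (Real.sqrt ((L : ℝ)⁻¹)) ^ i := by
  have hL : 0 ≤ ((L : ℝ)⁻¹) := inv_nonneg.mpr (Nat.cast_nonneg L)
  rw [Real.sqrt_mul hγ, sqrt_pow_eq hL i, Real.sqrt_mul (Real.sqrt_nonneg γ), sqrt_pow_eq (Real.sqrt_nonneg _) i]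

/-- The ratio `r = L^{−1/4}` satisfies `0 ≤ r` and `r ≤ √(√(1/2)) < 1` for `L ≥ 2`. [folklore] -/
theorem ratio_bounds {L : ℕ} (hL : 2 ≤ L) :
    0 ≤ Real.sqrt (Real.sqrt ((L : ℝ)⁻¹)) ∧ Real.sqrt (Real.sqrt ((L : ℝ)⁻¹)) ≤ Real.sqrt (Real.sqrt (1 / 2)) ∧
      Real.sqrt (Real.sqrt (1 / 2 : ℝ)) < 1 := by
  refine ⟨Real.sqrt_nonneg _, ?_, ?_⟩
  · apply Real.sqrt_le_sqrt
    apply Real.sqrt_le_sqrt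
    rw [one_div]
    exact inv_anti₀ (by norm_num) (by exact_mod_cast hL)
  · have h1 : Real.sqrt (1 / 2 : ℝ) < 1 := by
      rw [show (1 : ℝ) = Real.sqrt 1 from Real.sqrt_one.symm]
      exact Real.sqrt_lt_sqrt (by norm_num) (by norm_num)
    have h0 : 0 ≤ Real.sqrt (1 / 2 : ℝ) := Real.sqrt_nonneg _
    calc Real.sqrt (Real.sqrt (1 / 2 : ℝ)) < Real.sqrt 1 := Real.sqrt_lt_sqrt h0 h1
      _ = 1 := Real.sqrt_one

/-- **★ THE THRESHOLDS ARE SUMMABLE OVER THE HEIGHTS**: for `L ≥ 2`, `0 < γ ≤ 1`, `b₀ ≥ 0`, `p₀ > 0` and EVERY finite set `s` of heights,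
`Σ_{n ∈ s} θ(n) ≤ b₀(2p₀)^{p₀}e^{½−p₀} · γ^{1/4} · (1 − √(√(1/2)))⁻¹` — geometric decay `θ(n) ≤ C·(γL^{−n})^{1/4}` (✓`θBal_le_const_mul_sqrt_coupling`) summed
against the full geometric series of ratio `L^{−1/4} ≤ 2^{−1/4}`. [cite: Balaban1985UV3, (7) p.257] -/
theorem sum_θBal_le {L : ℕ} (hL : 2 ≤ L) {γ b₀ p₀ : ℝ} (hγ : 0 < γ) (hγ1 : γ ≤ 1) (hb : 0 ≤ b₀) (hp : 0 < p₀) (s : Finset ℕ) :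
    ∑ n ∈ s, θBal L γ b₀ p₀ n ≤
      b₀ * ((2 * p₀) ^ p₀ * Real.exp (1 / 2 - p₀)) * Real.sqrt (Real.sqrt γ) * (1 - Real.sqrt (Real.sqrt (1 / 2 : ℝ)))⁻¹ := by
  obtain ⟨hr0, hrle, hhalf⟩ := ratio_bounds hL
  set r : ℝ := Real.sqrt (Real.sqrt ((L : ℝ)⁻¹)) with hr
  set r₂ : ℝ := Real.sqrt (Real.sqrt (1 / 2 : ℝ)) with hr₂
  set C : ℝ := b₀ * ((2 * p₀) ^ p₀ * Real.exp (1 / 2 - p₀)) with hC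
  have hC0 : 0 ≤ C := by rw [hC]; positivity
  have hr1 : r < 1 := hrle.trans_lt hhalf
  have hr₂0 : 0 ≤ r₂ := Real.sqrt_nonneg _
  -- termwise: `θ(n) ≤ C·√(√γ)·r^n`
  have hterm : ∀ n, θBal L γ b₀ p₀ n ≤ C * Real.sqrt (Real.sqrt γ) * r ^ n := by
    intro n
    have h := T3Thresholds.θBal_le_const_mul_sqrt_coupling (L := L) (by omega) hγ hγ1 hb hp n
    rw [sqrt_sqrt_coupling_eq hγ.le n, ← mul_assoc] at h
    exact h
  -- the geometric series
  have hgeom : ∑ n ∈ s, r ^ n ≤ (1 - r)⁻¹ := by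
    have hsum : Summable fun n : ℕ => r ^ n := summable_geometric_of_lt_one hr0 hr1
    calc ∑ n ∈ s, r ^ n ≤ ∑' n : ℕ, r ^ n := hsum.sum_le_tsum s fun n _ => pow_nonneg hr0 n
      _ = (1 - r)⁻¹ := tsum_geometric_of_lt_one hr0 hr1
  have hinv : (1 - r)⁻¹ ≤ (1 - r₂)⁻¹ := by
    apply inv_anti₀ (by linarith) (by linarith)
  calc ∑ n ∈ s, θBal L γ b₀ p₀ n ≤ ∑ n ∈ s, C * Real.sqrt (Real.sqrt γ) * r ^ n := Finset.sum_le_sum fun n _ => hterm n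
    _ = C * Real.sqrt (Real.sqrt γ) * ∑ n ∈ s, r ^ n := by rw [Finset.mul_sum]
    _ ≤ C * Real.sqrt (Real.sqrt γ) * (1 - r)⁻¹ := mul_le_mul_of_nonneg_left hgeom (by positivity)
    _ ≤ C * Real.sqrt (Real.sqrt γ) * (1 - r₂)⁻¹ := mul_le_mul_of_nonneg_left hinv (by positivity)

/-- **★ ONE COUPLING FOR ALL HEIGHT SUMS**: for `b₀, p₀ > 0` and every `σ > 0` there is `γ₁ ∈ (0, 1]` such that for every `L ≥ 2`, every `γ ∈ (0, γ₁]`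
and every finite set `s` of heights, `Σ_{n ∈ s} θ(n) ≤ σ` — how «Σ_{i<k} a_i = O(1) uniformly in k» (the k-uniformity input of the true-linearisation
bricks) is read along the d = 3 families. [cite: Balaban1985UV3, (7) p.257, p.267] -/
theorem exists_gamma_forall_sum_θBal_le {b₀ p₀ : ℝ} (hb : 0 < b₀) (hp : 0 < p₀) {σ : ℝ} (hσ : 0 < σ) :
    ∃ γ₁ : ℝ, 0 < γ₁ ∧ γ₁ ≤ 1 ∧
      ∀ L : ℕ, 2 ≤ L → ∀ γ : ℝ, 0 < γ → γ ≤ γ₁ → ∀ s : Finset ℕ, ∑ n ∈ s, θBal L γ b₀ p₀ n ≤ σ := by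
  set C : ℝ := b₀ * ((2 * p₀) ^ p₀ * Real.exp (1 / 2 - p₀)) with hC
  set D : ℝ := (1 - Real.sqrt (Real.sqrt (1 / 2 : ℝ)))⁻¹ with hD
  have hC : 0 < C := by rw [hC]; positivity
  have hhalf := (ratio_bounds (L := 2) le_rfl).2.2
  have hD : 0 < D := by rw [hD]; exact inv_pos.mpr (by linarith)
  -- choose `γ₁` with `C·γ₁^{1/4}·D ≤ σ`: `γ₁ := min 1 ((σ/(C·D))²)²`
  set t : ℝ := σ / (C * D) with ht
  have ht0 : 0 < t := by rw [ht]; positivity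
  refine ⟨min 1 ((t ^ 2) ^ 2), lt_min one_pos (by positivity), min_le_left _ _, ?_⟩
  intro L hL γ hγ hγ₁ s
  have hγ1 : γ ≤ 1 := hγ₁.trans (min_le_left _ _)
  have hγt : γ ≤ (t ^ 2) ^ 2 := hγ₁.trans (min_le_right _ _)
  -- `√(√γ) ≤ t`
  have hsqrt : Real.sqrt (Real.sqrt γ) ≤ t := by
    have h1 : Real.sqrt γ ≤ t ^ 2 := by
      rw [show t ^ 2 = Real.sqrt ((t ^ 2) ^ 2) from (Real.sqrt_sq (by positivity)).symm]
      exact Real.sqrt_le_sqrt hγt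
    rw [show t = Real.sqrt (t ^ 2) from (Real.sqrt_sq ht0.le).symm]
    exact Real.sqrt_le_sqrt h1
  have h := sum_θBal_le hL hγ hγ1 hb.le hp s
  calc ∑ n ∈ s, θBal L γ b₀ p₀ n ≤ C * Real.sqrt (Real.sqrt γ) * D := h
    _ ≤ C * t * D := mul_le_mul_of_nonneg_right (mul_le_mul_of_nonneg_left hsqrt hC.le) hD.le
    _ = σ := by rw [ht]; field_simp

end Summit.QuantumFields.YangMills.Theorems.PoincareLipschitzThresholdSums

end
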